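/-
Copyright (c) 2026 the pub-hodgecm-mathlib formalisation cell (harness21).  Prover seat hodgecm-mathlib-K2E4-p10 (g7), Track B ∕ K2-LIT, h413 = `stmt-HodgeConjecture-24833`,
line `K2_E1_TraceFormulaBeta`, 5Res ROADCARD «ENDGAME BY FAMILIES» §3′ M2 v2, D-road letter `hTB` (K2E1-plan (g7) (244)∕(248)(a)): the `χ`-BI-AVERAGE of a test function and the
COMPRESSION IDENTITY `P_χ ∘ R₁(a) ∘ P_χ = R₁(a♮)` — the missing brick between ★ `K2E1TauSphericalHeckeCommutativeU11` (Gelfand) and the compression commutation `hTB` of ★ D5′.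
-/
import Summits.HodgeConjecture.HodgeConjecture.Theorems.K2E1TauSphericalHeckeCommutativeU11    -- ★ p860461 (K2E2-p12): Gelfand `integratedOperator_comm_of_spherical`; brings ★ p860372 `K2E1KTypeProjectorPureTensorU` (`P_χ`), ★ p860333, ★ `IntegratedOperatorStar`, ★ `IntegratedOperatorFixedVectors`
import Mathlib.MeasureTheory.Integral.Bochner.Set
import HarnessLib

/-!
# D-road `hTB` brick — `K2E1KTypeCompressionAverageU`: the `χ`-bi-average `a♮(x) = ∫_K∫_K χ(k)χ(k′)·a((κk)⁻¹·x·(κk′)⁻¹)` of `a ∈ C_c(G₁)` is in `C_c(G₁)`, is `χ`-SPHERICAL, and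
# `P_χ ∘L R₁(a) ∘L P_χ = R₁(a♮)` (`P_χ = ∫_K χ(k) π(ι₁κk) dμ`, `R₁(a) = ∫_{G₁} a(x) π(ι₁ x) dη₁`)

Track B ∕ K2-LIT, crux h413 = `stmt-HodgeConjecture-24833`, route of record `HCCMUnconditional`; cell `hodgecm-mathlib`, squad K2, ENGINE E1 (5Res campaign, M2 v2 D-road).  THEOREMS ONLY
(no `def`, no `instance`, no `notation`, no named-fact hypothesis, no `sorry`; default heartbeats); lane `--supports stmt-HodgeConjecture-24833 --as helper` (count-neutral).  Generic:
`π` a unitary strongly continuous representation of `G` on a Hilbert space, `ι₁ : G₁ →* G` (E1: `G_∞ ↪ G(𝔸)`), `κ : K →* G₁` (E1: `K_∞ ↪ G_∞`, `K` compact), `χ ∈ C_c(K)` multiplicative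
(E1: `conj τ`), `μ` a two-sided-invariant probability on `K`, `η₁` a two-sided-invariant measure on `G₁` finite on compacta.
THE MATHEMATICS ([Knapp1986, VIII §3]; [DeitmarEchterhoff2014, Lemma 1.6.3, Prop. 6.2.1]; [Helgason2000, IV §3]).  ★ `apply_comp_integratedOperator` (`π(g)R₁(a) = R₁(λ_g a)`) and ★
`integratedOperator_comp_apply_eq` (`R₁(a)π(g) = R₁(ρ_g a)`) integrated over `K` against `χ` (Fubini on `K × G₁`, the integrand being continuous of compact support) give
`P_χ ∘ R₁(a) = R₁(aᴸ)`, `aᴸ(x) = ∫_K χ(k)·a((κk)⁻¹x) dμ` (§3) and `R₁(a) ∘ P_χ = R₁(aᴿ)`, `aᴿ(x) = ∫_K χ(k)·a(x(κk)⁻¹) dμ` (§3); the averages are again in `C_c(G₁)` (§2: continuity by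
Mathlib `continuous_parametric_integral_of_continuous` over the compact `K`, support in `κ(K)·supp a`, resp. `supp a·κ(K)`); `aᴸ` is LEFT `χ`-equivariant, `aᴿ` RIGHT `χ`-equivariant and
right-averaging preserves left equivariance (§4, invariance of `μ`).  Hence (§5 HEAD) **`exists_spherical_compression`**: `∃ a♮ ∈ C_c(G₁)`, `χ`-spherical on both sides (the shapes of ★
`hh_of_spherical` ∕ ★ `integratedOperator_comm_of_spherical`), with `P_χ ∘L R₁(a) ∘L P_χ = R₁(a♮)` — so Gelfand's trick ★ p860461 («`R₁(h)R₁(f) = R₁(f)R₁(h)` for `χ`-spherical `h, f`»)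
yields `Commute (R₁ h) (P_χ ∘L R₁ a ∘L P_χ)` for EVERY `a ∈ C_c(G₁)` (§5 `commute_compression_of_gelfand`), the arch heart of the D-road letter `hTB` (★ D5′ p860349 ∕ p860487).
* §1 translates as `C_c`: `exists_leftTranslate`, `exists_rightTranslate`.  * §2 averages as `C_c`: `exists_leftAverage`, `exists_rightAverage`.
* §3 `kType_comp_integratedOperator_eq_average` (`P_χ ∘L R₁ a = R₁ aᴸ`), `integratedOperator_comp_kType_eq_average` (`R₁ a ∘L P_χ = R₁ aᴿ`).
* §4 `leftAverage_left`, `rightAverage_right`, `rightAverage_left` (equivariance).  * §5 **`exists_spherical_compression`**, **`commute_compression_of_gelfand`**.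
HONEST LABEL: HC_CM is proved only modulo the 7 printed citations (2 remaining named inputs: hLiu418 = `stmt-HodgeConjecture-24832`, h413 = `stmt-HodgeConjecture-24833`) until rung 0
closes; this file asserts no named fact and closes no socket; count-neutral; unconditional (the Gelfand data `θ, hθη, hconj` of §5's last theorem are ★ p860461's letters, visible).

## References
* [Knapp1986] A. W. Knapp, *Representation Theory of Semisimple Groups* (1986), VIII §3.
* [DeitmarEchterhoff2014] A. Deitmar, S. Echterhoff, *Principles of Harmonic Analysis* (2nd ed., 2014), Lemma 1.6.3, Prop. 6.2.1.
* [Helgason2000] S. Helgason, *Groups and Geometric Analysis* (2000), Ch. IV §3.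
-/

set_option autoImplicit false
set_option linter.dupNamespace false -- the mandated namespace repeats `HodgeConjecture.HodgeConjecture`

noncomputable section

open MeasureTheory Filter Topology CompactlySupported Function
open scoped Pointwise
open Literature.NumberTheory.Automorphic
open Summit.HodgeConjecture.HodgeConjecture.Cruxes.H413.K2E1TauSphericalHeckeCommutativeU11 (integratedOperator_comm_of_spherical)

namespace Summit.HodgeConjecture.HodgeConjecture.Cruxes.H413.K2E1KTypeCompressionAverageU

/-! ## §1 Translates of a test function as `C_c` functions -/

section Translate

variable {G₁ : Type*} [Group G₁] [TopologicalSpace G₁] [IsTopologicalGroup G₁]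

/-- The left translate `x ↦ a(g⁻¹x)` of `a ∈ C_c(G₁)` is in `C_c(G₁)`. [folklore] -/
theorem exists_leftTranslate (a : C_c(G₁, ℂ)) (g : G₁) : ∃ b : C_c(G₁, ℂ), ∀ x, b x = a (g⁻¹ * x) :=
  ⟨⟨⟨fun x => a (g⁻¹ * x), a.continuous.comp (continuous_const.mul continuous_id)⟩, a.hasCompactSupport.comp_homeomorph (Homeomorph.mulLeft g⁻¹)⟩, fun _ => rfl⟩

/-- The right translate `x ↦ a(x g⁻¹)` of `a ∈ C_c(G₁)` is in `C_c(G₁)`. [folklore] -/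
theorem exists_rightTranslate (a : C_c(G₁, ℂ)) (g : G₁) : ∃ b : C_c(G₁, ℂ), ∀ x, b x = a (x * g⁻¹) :=
  ⟨⟨⟨fun x => a (x * g⁻¹), a.continuous.comp (continuous_id.mul continuous_const)⟩, a.hasCompactSupport.comp_homeomorph (Homeomorph.mulRight g⁻¹)⟩, fun _ => rfl⟩

end Translate

/-! ## §2 The one-sided `χ`-averages as `C_c` functions -/

section Average

variable {G₁ K : Type*} [Group G₁] [TopologicalSpace G₁] [IsTopologicalGroup G₁] [LocallyCompactSpace G₁] [FirstCountableTopology G₁]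
  [Group K] [TopologicalSpace K] [CompactSpace K] [MeasurableSpace K] [OpensMeasurableSpace K]
  (κ : K →* G₁) (hκ : Continuous κ) (μ : Measure K) [IsFiniteMeasure μ] (χ : C_c(K, ℂ))

include hκ in
/-- **THE LEFT `χ`-AVERAGE `aᴸ(x) = ∫_K χ(k)·a((κk)⁻¹x) dμ` IS IN `C_c(G₁)`** (continuous: parametric integral over the compact `K`; support in `κ(K)·supp a`). [cite: Knapp1986, VIII §3] -/
theorem exists_leftAverage (a : C_c(G₁, ℂ)) : ∃ aL : C_c(G₁, ℂ), ∀ x, aL x = ∫ k, χ k * a ((κ k)⁻¹ * x) ∂μ := by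
  have hcont : Continuous fun x : G₁ => ∫ k, χ k * a ((κ k)⁻¹ * x) ∂μ := by
    have h := continuous_parametric_integral_of_continuous (μ := μ) (f := fun (x : G₁) (k : K) => χ k * a ((κ k)⁻¹ * x))
      ((χ.continuous.comp continuous_snd).mul (a.continuous.comp (((hκ.comp continuous_snd).inv).mul continuous_fst))) isCompact_univ
    simpa only [Measure.restrict_univ] using h
  have hsupp : HasCompactSupport fun x : G₁ => ∫ k, χ k * a ((κ k)⁻¹ * x) ∂μ := by
    refine HasCompactSupport.intro ((isCompact_range hκ).mul a.hasCompactSupport) fun x hx => ?_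
    refine integral_eq_zero_of_ae (Eventually.of_forall fun k => ?_)
    have hk : (κ k)⁻¹ * x ∉ tsupport a := fun hmem => hx ⟨κ k, Set.mem_range_self k, (κ k)⁻¹ * x, hmem, by group⟩
    simp only [image_eq_zero_of_notMem_tsupport hk, mul_zero, Pi.zero_apply]
  exact ⟨⟨⟨_, hcont⟩, hsupp⟩, fun _ => rfl⟩

include hκ in
/-- **THE RIGHT `χ`-AVERAGE `aᴿ(x) = ∫_K χ(k)·a(x(κk)⁻¹) dμ` IS IN `C_c(G₁)`** (support in `supp a·κ(K)`). [cite: Knapp1986, VIII §3] -/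
theorem exists_rightAverage (a : C_c(G₁, ℂ)) : ∃ aR : C_c(G₁, ℂ), ∀ x, aR x = ∫ k, χ k * a (x * (κ k)⁻¹) ∂μ := by
  have hcont : Continuous fun x : G₁ => ∫ k, χ k * a (x * (κ k)⁻¹) ∂μ := by
    have h := continuous_parametric_integral_of_continuous (μ := μ) (f := fun (x : G₁) (k : K) => χ k * a (x * (κ k)⁻¹))
      ((χ.continuous.comp continuous_snd).mul (a.continuous.comp (continuous_fst.mul ((hκ.comp continuous_snd).inv)))) isCompact_univ
    simpa only [Measure.restrict_univ] using h
  have hsupp : HasCompactSupport fun x : G₁ => ∫ k, χ k * a (x * (κ k)⁻¹) ∂μ := by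
    refine HasCompactSupport.intro (a.hasCompactSupport.mul (isCompact_range hκ)) fun x hx => ?_
    refine integral_eq_zero_of_ae (Eventually.of_forall fun k => ?_)
    have hk : x * (κ k)⁻¹ ∉ tsupport a := fun hmem => hx ⟨x * (κ k)⁻¹, hmem, κ k, Set.mem_range_self k, by group⟩
    simp only [image_eq_zero_of_notMem_tsupport hk, mul_zero, Pi.zero_apply]
  exact ⟨⟨⟨_, hcont⟩, hsupp⟩, fun _ => rfl⟩

end Average

/-! ## §3 The operator identities `P_χ ∘ R₁(a) = R₁(aᴸ)`, `R₁(a) ∘ P_χ = R₁(aᴿ)` -/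

section Operator

variable {G G₁ K V : Type*} [Group G] [TopologicalSpace G]
  [Group G₁] [TopologicalSpace G₁] [IsTopologicalGroup G₁] [SecondCountableTopology G₁] [MeasurableSpace G₁] [BorelSpace G₁]
  [Group K] [TopologicalSpace K] [IsTopologicalGroup K] [CompactSpace K] [MeasurableSpace K] [BorelSpace K]
  [NormedAddCommGroup V] [InnerProductSpace ℂ V] [CompleteSpace V]
  (π : ContRepresentation ℂ G V) (hu : π.IsUnitary) (hc : π.IsStronglyContinuous)
  (ι₁ : G₁ →* G) (hι₁ : Continuous ι₁) (κ : K →* G₁) (hκ : Continuous κ)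
  (μ : Measure K) [IsFiniteMeasureOnCompacts μ] (χ : C_c(K, ℂ))
  (η₁ : Measure G₁) [IsFiniteMeasureOnCompacts η₁] [SFinite η₁]

omit [CompleteSpace V] [SFinite η₁] in
include hκ hι₁ hc in
/-- The Fubini integrand `(k, x) ↦ (χ(k)·a((κk)⁻¹x)) • π(ι₁x)v` is integrable on `K × G₁` (continuous, supported in `K × κ(K)·supp a`). [cite: DeitmarEchterhoff2014, Prop. 6.2.1] -/
theorem integrable_leftAverage_integrand (a : C_c(G₁, ℂ)) (v : V) :
    Integrable (uncurry fun (k : K) (x : G₁) => (χ k * a ((κ k)⁻¹ * x)) • π (ι₁ x) v) (μ.prod η₁) := by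
  apply Continuous.integrable_of_hasCompactSupport
  · exact ((χ.continuous.comp continuous_fst).mul (a.continuous.comp (((hκ.comp continuous_fst).inv).mul continuous_snd))).smul ((hc v).comp (hι₁.comp continuous_snd))
  · refine HasCompactSupport.intro (isCompact_univ.prod ((isCompact_range hκ).mul a.hasCompactSupport)) ?_
    rintro ⟨k, x⟩ hkx
    have hx : x ∉ Set.range κ * tsupport a := fun h => hkx ⟨Set.mem_univ _, h⟩
    have hk : (κ k)⁻¹ * x ∉ tsupport a := fun hmem => hx ⟨κ k, Set.mem_range_self k, (κ k)⁻¹ * x, hmem, by group⟩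
    simp only [uncurry_apply_pair, image_eq_zero_of_notMem_tsupport hk, mul_zero, zero_smul]

omit [CompleteSpace V] [SFinite η₁] in
include hκ hι₁ hc in
/-- The Fubini integrand `(k, x) ↦ (χ(k)·a(x(κk)⁻¹)) • π(ι₁x)v` is integrable on `K × G₁`. [cite: DeitmarEchterhoff2014, Prop. 6.2.1] -/
theorem integrable_rightAverage_integrand (a : C_c(G₁, ℂ)) (v : V) :
    Integrable (uncurry fun (k : K) (x : G₁) => (χ k * a (x * (κ k)⁻¹)) • π (ι₁ x) v) (μ.prod η₁) := by
  apply Continuous.integrable_of_hasCompactSupport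
  · exact ((χ.continuous.comp continuous_fst).mul (a.continuous.comp (continuous_snd.mul ((hκ.comp continuous_fst).inv)))).smul ((hc v).comp (hι₁.comp continuous_snd))
  · refine HasCompactSupport.intro (isCompact_univ.prod (a.hasCompactSupport.mul (isCompact_range hκ))) ?_
    rintro ⟨k, x⟩ hkx
    have hx : x ∉ tsupport a * Set.range κ := fun h => hkx ⟨Set.mem_univ _, h⟩
    have hk : x * (κ k)⁻¹ ∉ tsupport a := fun hmem => hx ⟨x * (κ k)⁻¹, hmem, κ k, Set.mem_range_self k, by group⟩
    simp only [uncurry_apply_pair, image_eq_zero_of_notMem_tsupport hk, mul_zero, zero_smul]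

include hκ in
/-- **`P_χ ∘ R₁(a) = R₁(aᴸ)`** for any `aᴸ ∈ C_c(G₁)` with `aᴸ(x) = ∫_K χ(k)·a((κk)⁻¹x) dμ` (★ `apply_comp_integratedOperator` under the `K`-integral, Fubini; `η₁` left-invariant).
[cite: Knapp1986, VIII §3] [cite: DeitmarEchterhoff2014, Lemma 1.6.3] -/
theorem kType_comp_integratedOperator_eq_average [MeasurableMul G₁] [η₁.IsMulLeftInvariant] (a aL : C_c(G₁, ℂ)) (haL : ∀ x, aL x = ∫ k, χ k * a ((κ k)⁻¹ * x) ∂μ) :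
    (π.restrict (ι₁.comp κ)).integratedOperator (hu.restrict (ι₁.comp κ)) (hc.restrict (ι₁.comp κ) (hι₁.comp hκ)) μ χ ∘L
        (π.restrict ι₁).integratedOperator (hu.restrict ι₁) (hc.restrict ι₁ hι₁) η₁ a =
      (π.restrict ι₁).integratedOperator (hu.restrict ι₁) (hc.restrict ι₁ hι₁) η₁ aL := by
  ext v
  rw [ContinuousLinearMap.comp_apply, ContRepresentation.integratedOperator_apply (hu.restrict (ι₁.comp κ)) _ μ χ,
    ContRepresentation.integratedOperator_apply (hu.restrict ι₁) _ η₁ aL]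
  have h1 : ∀ k : K, χ k • (π.restrict (ι₁.comp κ)) k ((π.restrict ι₁).integratedOperator (hu.restrict ι₁) (hc.restrict ι₁ hι₁) η₁ a v) =
      ∫ x, (χ k * a ((κ k)⁻¹ * x)) • π (ι₁ x) v ∂η₁ := fun k => by
    obtain ⟨b, hb⟩ := exists_leftTranslate a (κ k)
    have e : ((π.restrict ι₁) (κ k) ∘L (π.restrict ι₁).integratedOperator (hu.restrict ι₁) (hc.restrict ι₁ hι₁) η₁ a) v =
        (π.restrict ι₁).integratedOperator (hu.restrict ι₁) (hc.restrict ι₁ hι₁) η₁ b v := by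
      rw [ContRepresentation.apply_comp_integratedOperator (hu.restrict ι₁) (hc.restrict ι₁ hι₁) η₁ (κ k) a b hb]
    rw [ContinuousLinearMap.comp_apply, ContRepresentation.restrict_apply] at e
    rw [ContRepresentation.restrict_apply, MonoidHom.comp_apply, e, ContRepresentation.integratedOperator_apply, ← integral_smul]
    refine integral_congr_ae (Eventually.of_forall fun x => ?_)
    beta_reduce
    rw [hb, ContRepresentation.restrict_apply, smul_smul]
  simp_rw [h1]
  rw [integral_integral_swap (integrable_leftAverage_integrand (π := π) (hc := hc) (ι₁ := ι₁) (hι₁ := hι₁) (κ := κ) (hκ := hκ) (μ := μ) (χ := χ) (η₁ := η₁) a v)]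
  refine integral_congr_ae (Eventually.of_forall fun x => ?_)
  beta_reduce
  rw [integral_smul_const, haL, ContRepresentation.restrict_apply]

include hκ in
/-- **`R₁(a) ∘ P_χ = R₁(aᴿ)`** for any `aᴿ ∈ C_c(G₁)` with `aᴿ(x) = ∫_K χ(k)·a(x(κk)⁻¹) dμ` (★ `integratedOperator_comp_apply_eq` under the `K`-integral, Fubini; `η₁` right-invariant).
[cite: Knapp1986, VIII §3] [cite: DeitmarEchterhoff2014, Lemma 1.6.3] -/
theorem integratedOperator_comp_kType_eq_average [MeasurableMul G₁] [η₁.IsMulRightInvariant] (a aR : C_c(G₁, ℂ)) (haR : ∀ x, aR x = ∫ k, χ k * a (x * (κ k)⁻¹) ∂μ) :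
    (π.restrict ι₁).integratedOperator (hu.restrict ι₁) (hc.restrict ι₁ hι₁) η₁ a ∘L
        (π.restrict (ι₁.comp κ)).integratedOperator (hu.restrict (ι₁.comp κ)) (hc.restrict (ι₁.comp κ) (hι₁.comp hκ)) μ χ =
      (π.restrict ι₁).integratedOperator (hu.restrict ι₁) (hc.restrict ι₁ hι₁) η₁ aR := by
  ext v
  rw [ContinuousLinearMap.comp_apply, ContRepresentation.integratedOperator_apply (hu.restrict (ι₁.comp κ)), ContRepresentation.integratedOperator_apply _ _ η₁ aR,
    ← ContinuousLinearMap.integral_comp_comm _ (ContRepresentation.integrable_smul_apply (hc.restrict (ι₁.comp κ) (hι₁.comp hκ)) μ χ v)]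
  have h1 : ∀ k : K, (π.restrict ι₁).integratedOperator (hu.restrict ι₁) (hc.restrict ι₁ hι₁) η₁ a (χ k • (π.restrict (ι₁.comp κ)) k v) =
      ∫ x, (χ k * a (x * (κ k)⁻¹)) • π (ι₁ x) v ∂η₁ := fun k => by
    obtain ⟨b, hb⟩ := exists_rightTranslate a (κ k)
    have e : ((π.restrict ι₁).integratedOperator (hu.restrict ι₁) (hc.restrict ι₁ hι₁) η₁ a ∘L (π.restrict ι₁) (κ k)) v =
        (π.restrict ι₁).integratedOperator (hu.restrict ι₁) (hc.restrict ι₁ hι₁) η₁ b v := by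
      rw [ContRepresentation.integratedOperator_comp_apply_eq (hu.restrict ι₁) (hc.restrict ι₁ hι₁) η₁ (κ k) a b hb]
    rw [ContinuousLinearMap.comp_apply, ContRepresentation.restrict_apply] at e
    rw [ContinuousLinearMap.map_smul, ContRepresentation.restrict_apply, MonoidHom.comp_apply, e, ContRepresentation.integratedOperator_apply, ← integral_smul]
    refine integral_congr_ae (Eventually.of_forall fun x => ?_)
    beta_reduce
    rw [hb, ContRepresentation.restrict_apply, smul_smul]
  simp_rw [h1]
  rw [integral_integral_swap (integrable_rightAverage_integrand (π := π) (hc := hc) (ι₁ := ι₁) (hι₁ := hι₁) (κ := κ) (hκ := hκ) (μ := μ) (χ := χ) (η₁ := η₁) a v)]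
  refine integral_congr_ae (Eventually.of_forall fun x => ?_)
  beta_reduce
  rw [integral_smul_const, haR, ContRepresentation.restrict_apply]

end Operator

/-! ## §4 Equivariance of the averages -/

section Equivariance

variable {G₁ K : Type*} [Group G₁] [Group K] [MeasurableSpace K] [MeasurableMul K] (κ : K →* G₁) (μ : Measure K) (χ : K → ℂ)
  (hχmul : ∀ k l, χ (k * l) = χ k * χ l)

include hχmul in
/-- **The left average is LEFT `χ`-equivariant**: `aᴸ(κk₀·x) = χ(k₀)·aᴸ(x)` (substitute `k ↦ k₀k`; `μ` left-invariant, `χ` multiplicative). [cite: Knapp1986, VIII §3] -/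
theorem leftAverage_left [μ.IsMulLeftInvariant] {a aL : G₁ → ℂ} (haL : ∀ x, aL x = ∫ k, χ k * a ((κ k)⁻¹ * x) ∂μ) (k₀ : K) (x : G₁) :
    aL (κ k₀ * x) = χ k₀ * aL x := by
  rw [haL, haL, ← integral_const_mul, ← integral_mul_left_eq_self _ k₀]
  refine integral_congr_ae (Eventually.of_forall fun k => ?_)
  beta_reduce
  rw [hχmul, map_mul, mul_inv_rev, mul_assoc ((κ k)⁻¹), inv_mul_cancel_left, mul_assoc]

include hχmul in
/-- **The right average is RIGHT `χ`-equivariant**: `aᴿ(x·κk₀) = χ(k₀)·aᴿ(x)` (substitute `k ↦ kk₀`; `μ` right-invariant). [cite: Knapp1986, VIII §3] -/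
theorem rightAverage_right [μ.IsMulRightInvariant] {a aR : G₁ → ℂ} (haR : ∀ x, aR x = ∫ k, χ k * a (x * (κ k)⁻¹) ∂μ) (k₀ : K) (x : G₁) :
    aR (x * κ k₀) = χ k₀ * aR x := by
  rw [haR, haR, ← integral_const_mul, ← integral_mul_right_eq_self _ k₀]
  refine integral_congr_ae (Eventually.of_forall fun k => ?_)
  beta_reduce
  rw [hχmul, map_mul, mul_inv_rev, ← mul_assoc (x * κ k₀), mul_inv_cancel_right]
  ring

omit [MeasurableMul K] in
/-- **Left-averaging preserves RIGHT equivariance**: if `a(x·κk₀) = χ(k₀)a(x)` then the same holds for `aᴸ`. [folklore] -/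
theorem leftAverage_right {a aL : G₁ → ℂ} (haL : ∀ x, aL x = ∫ k, χ k * a ((κ k)⁻¹ * x) ∂μ) (ha : ∀ (k₀ : K) (x : G₁), a (x * κ k₀) = χ k₀ * a x) (k₀ : K) (x : G₁) :
    aL (x * κ k₀) = χ k₀ * aL x := by
  rw [haL, haL, ← integral_const_mul]
  refine integral_congr_ae (Eventually.of_forall fun k => ?_)
  beta_reduce
  rw [← mul_assoc, ha]
  ring

end Equivariance

/-! ## §5 HEAD: the `χ`-spherical compression and Gelfand's commutation -/

section Head

variable {G G₁ K V : Type*} [Group G] [TopologicalSpace G]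
  [Group G₁] [TopologicalSpace G₁] [IsTopologicalGroup G₁] [LocallyCompactSpace G₁] [SecondCountableTopology G₁] [MeasurableSpace G₁] [BorelSpace G₁] [MeasurableMul G₁]
  [Group K] [TopologicalSpace K] [IsTopologicalGroup K] [CompactSpace K] [MeasurableSpace K] [BorelSpace K] [MeasurableMul K]
  [NormedAddCommGroup V] [InnerProductSpace ℂ V] [CompleteSpace V]
  (π : ContRepresentation ℂ G V) (hu : π.IsUnitary) (hc : π.IsStronglyContinuous)
  (ι₁ : G₁ →* G) (hι₁ : Continuous ι₁) (κ : K →* G₁) (hκ : Continuous κ)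
  (μ : Measure K) [IsFiniteMeasureOnCompacts μ] [μ.IsMulLeftInvariant] [μ.IsMulRightInvariant] (χ : C_c(K, ℂ)) (hχmul : ∀ k l, χ (k * l) = χ k * χ l)
  (η₁ : Measure G₁) [IsFiniteMeasureOnCompacts η₁] [SFinite η₁] [η₁.IsMulLeftInvariant] [η₁.IsMulRightInvariant]

include hκ hχmul in
/-- **THE `χ`-SPHERICAL COMPRESSION**: for every `a ∈ C_c(G₁)` there is `a♮ ∈ C_c(G₁)`, `χ`-SPHERICAL on both sides (`a♮(κk·x) = χ(k)a♮(x) = a♮(x·κk)` — the shapes of ★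
`hh_of_spherical` ∕ ★ `integratedOperator_comm_of_spherical`), with **`P_χ ∘L R₁(a) ∘L P_χ = R₁(a♮)`** (`a♮ = (aᴿ)ᴸ`, §3 twice). [cite: Knapp1986, VIII §3] [cite: Helgason2000, IV §3] -/
theorem exists_spherical_compression (a : C_c(G₁, ℂ)) :
    ∃ an : C_c(G₁, ℂ), (∀ (k : K) (x : G₁), an (κ k * x) = χ k * an x) ∧ (∀ (k : K) (x : G₁), an (x * κ k) = χ k * an x) ∧
      (π.restrict (ι₁.comp κ)).integratedOperator (hu.restrict (ι₁.comp κ)) (hc.restrict (ι₁.comp κ) (hι₁.comp hκ)) μ χ ∘L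
          (π.restrict ι₁).integratedOperator (hu.restrict ι₁) (hc.restrict ι₁ hι₁) η₁ a ∘L
          (π.restrict (ι₁.comp κ)).integratedOperator (hu.restrict (ι₁.comp κ)) (hc.restrict (ι₁.comp κ) (hι₁.comp hκ)) μ χ =
        (π.restrict ι₁).integratedOperator (hu.restrict ι₁) (hc.restrict ι₁ hι₁) η₁ an := by
  obtain ⟨aR, haR⟩ := exists_rightAverage κ hκ μ χ a
  obtain ⟨aRL, haRL⟩ := exists_leftAverage κ hκ μ χ aR
  refine ⟨aRL, fun k x => leftAverage_left κ μ (⇑χ) hχmul haRL k x,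
    fun k x => leftAverage_right κ μ (⇑χ) haRL (fun k₀ y => rightAverage_right κ μ (⇑χ) hχmul haR k₀ y) k x, ?_⟩
  rw [integratedOperator_comp_kType_eq_average π hu hc ι₁ hι₁ κ hκ μ χ η₁ a aR haR,
    kType_comp_integratedOperator_eq_average π hu hc ι₁ hι₁ κ hκ μ χ η₁ aR aRL haRL]

include hκ hχmul in
/-- **GELFAND ⇒ `R₁(h)` COMMUTES WITH EVERY COMPRESSION `P_χ ∘L R₁(a) ∘L P_χ`** for `χ`-spherical `h ∈ C_c(G₁)`: by `exists_spherical_compression` the compression is `R₁(a♮)` with `a♮`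
`χ`-spherical, and ★ p860461 `integratedOperator_comm_of_spherical` (Gelfand's trick with the anti-automorphism `θ`, the measure preservation `hθη` and the `K`-conjugacy `hconj` as
letters) commutes `R₁(h)` with `R₁(a♮)`.  This is the arch heart of the D-road letter `hTB`. [cite: Helgason2000, IV §3, Thm. 3.1] [cite: Knapp1986, VIII §3] -/
theorem commute_compression_of_gelfand [η₁.IsInvInvariant]
    (θ : G₁ ≃ₜ G₁) (hθmul : ∀ x y : G₁, θ (x * y) = θ y * θ x) (hθη : MeasurePreserving θ η₁ η₁) (hχone : χ 1 = 1)
    (hconj : ∀ g : G₁, ∃ k : K, θ g = κ k * g * (κ k)⁻¹)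
    (h : C_c(G₁, ℂ)) (hhl : ∀ (k : K) (x : G₁), h (κ k * x) = χ k * h x) (hhr : ∀ (k : K) (x : G₁), h (x * κ k) = χ k * h x) (a : C_c(G₁, ℂ)) :
    Commute ((π.restrict ι₁).integratedOperator (hu.restrict ι₁) (hc.restrict ι₁ hι₁) η₁ h)
      ((π.restrict (ι₁.comp κ)).integratedOperator (hu.restrict (ι₁.comp κ)) (hc.restrict (ι₁.comp κ) (hι₁.comp hκ)) μ χ ∘L
          (π.restrict ι₁).integratedOperator (hu.restrict ι₁) (hc.restrict ι₁ hι₁) η₁ a ∘L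
          (π.restrict (ι₁.comp κ)).integratedOperator (hu.restrict (ι₁.comp κ)) (hc.restrict (ι₁.comp κ) (hι₁.comp hκ)) μ χ) := by
  obtain ⟨an, hanl, hanr, han⟩ := exists_spherical_compression π hu hc ι₁ hι₁ κ hκ μ χ hχmul η₁ a
  rw [han, Commute, SemiconjBy, ContinuousLinearMap.mul_def, ContinuousLinearMap.mul_def]
  exact integratedOperator_comm_of_spherical θ hθmul κ (⇑χ) η₁ hθη hχmul hχone hconj (π.restrict ι₁) (hu.restrict ι₁) (hc.restrict ι₁ hι₁) h an hhl hhr hanl hanr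

end Head

end Summit.HodgeConjecture.HodgeConjecture.Cruxes.H413.K2E1KTypeCompressionAverageU

end
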